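/-
HarnessLib.Audit.Status.Main — `status`: print the DERIVED status of the tree.

Phase 1 (no lakefile change):   cd lean && lake env lean --run HarnessLib/Audit/Status/Main.lean [flags]
Phase 2 (`[[lean_exe]] status`): cd lean && lake exe status [flags]

  --root M            status root module to load (repeatable); default: every `Summits/<S>/Status/Root.lean` found under
                      --lean-dir (module `Summits.<S>.Status.Root`)
  --lean-dir D        directory holding `Summits/` (default `.` = run from lean/)
  --summit S          only summit S            --bottleneck idea|work   only cruxes so judged (tier J filter)
  --open | --proved | --refuted | --modprint | --modclaim   only nodes with that derived status
                      (`closed_mod_claim` = closed only modulo ≥ 1 unrefereed CLAIM — a separate fact class, reported in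
                      its own `mod-claim` column / `modClaim` JSON fields, never counted as mod-print; schema status_version 3)
  --experiment        only cruxes carrying an experiment text        --orphans   only cruxes no thesis uses
  --with-notes        add tier-J columns (bottleneck / experiment / source) and evidence / barrier / lint lists
  --json              one JSON document (schema = `HarnessLib.Status.Report`, status_version 3)
  --live              ignore the reports stored by `#status_root`; re-classify the loaded environment (global fixpoint
                      across summits; also the fallback when a root stores nothing)
  --legacy-crux       with --live: also read `@[route_item … "crux"]` / `@[conjecture]` defs as cruxes
  --credit-parametrised  with --live: credit `∀ params, C params` proofs of parametrised nodes
  --direct            do NOT load the environment: read each root's `.olean` file alone and decode the stored report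
                      (milliseconds instead of the whole import; needs roots built with `#status_root` by THIS version of
                      `Classify.lean` — a root storing an older status_version is skipped with a rebuild hint)
  --quiet             no timing line on stderr

Default mode imports the root modules' .oleans (`importModules`, nothing is elaborated), reads the reports the roots
stored at build time (Lake's incremental build is the cache) and prints tier K.
-/
import HarnessLib.Audit.Status

open Lean HarnessLib.Status

namespace HarnessLib.Status.Main

structure Cli where
  roots      : Array Name := #[]
  leanDir    : System.FilePath := "."
  filter     : Filter := {}
  notes      : Bool := false
  json       : Bool := false
  live       : Bool := false
  direct     : Bool := false
  legacy     : Bool := false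
  creditParam : Bool := false
  quiet      : Bool := false

def usage : String :=
  "usage: status [--root M]* [--lean-dir D] [--summit S] [--bottleneck idea|work] [--open|--proved|--refuted|--modprint|--modclaim] " ++
  "[--experiment] [--orphans] [--with-notes] [--json] [--live [--legacy-crux] [--credit-parametrised]] [--direct] [--quiet]"

partial def parseArgs : List String → Cli → Except String Cli
  | [], c => .ok c
  | "--" :: r, c => parseArgs r c
  | "--root" :: m :: r, c => parseArgs r { c with roots := c.roots.push m.toName }
  | "--lean-dir" :: d :: r, c => parseArgs r { c with leanDir := d }
  | "--summit" :: s :: r, c => parseArgs r { c with filter := { c.filter with summit := some s } }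
  | "--bottleneck" :: b :: r, c =>
    if b == "idea" || b == "work" then parseArgs r { c with filter := { c.filter with bottleneck := some b } }
    else .error s!"--bottleneck expects idea|work, got '{b}'"
  | "--open" :: r, c => parseArgs r { c with filter := { c.filter with only := some "open" } }
  | "--proved" :: r, c => parseArgs r { c with filter := { c.filter with only := some "proved" } }
  | "--refuted" :: r, c => parseArgs r { c with filter := { c.filter with only := some "refuted" } }
  | "--modprint" :: r, c => parseArgs r { c with filter := { c.filter with only := some "closed_mod_print" } }
  | "--modclaim" :: r, c => parseArgs r { c with filter := { c.filter with only := some "closed_mod_claim" } }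
  | "--experiment" :: r, c => parseArgs r { c with filter := { c.filter with experiment := true } }
  | "--orphans" :: r, c => parseArgs r { c with filter := { c.filter with orphans := true } }
  | "--with-notes" :: r, c => parseArgs r { c with notes := true }
  | "--json" :: r, c => parseArgs r { c with json := true }
  | "--live" :: r, c => parseArgs r { c with live := true }
  | "--direct" :: r, c => parseArgs r { c with direct := true }
  | "--legacy-crux" :: r, c => parseArgs r { c with legacy := true }
  | "--credit-parametrised" :: r, c => parseArgs r { c with creditParam := true }
  | "--quiet" :: r, c => parseArgs r { c with quiet := true }
  | "--help" :: _, _ => .error usage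
  | a :: _, _ => .error s!"unknown argument '{a}'\n{usage}"

/-- `Summits/<S>/Status/Root.lean` under `dir` ↦ `Summits.<S>.Status.Root`, sorted. -/
def discoverRoots (dir : System.FilePath) : IO (Array Name) := do
  let top := dir / "Summits"
  unless ← top.isDir do return #[]
  let mut out := #[]
  for e in ← top.readDir do
    if ← (e.path / "Status" / "Root.lean").pathExists then
      out := out.push (Name.mkSimple "Summits" ++ Name.mkSimple e.fileName ++ `Status.Root)
  return out.qsort (·.toString < ·.toString)

/-! ### unsafe corners (interpreter initialisation; direct `.olean` decoding) -/

unsafe def enableInitsImpl : IO Unit := Lean.enableInitializersExecution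
/-- `Lean.enableInitializersExecution` (needed before `importModules (loadExts := true)` in a compiled binary; a
harmless no-op repeat under `lean --run`, where the frontend already enabled it). -/
@[implemented_by enableInitsImpl] opaque enableInits : IO Unit

unsafe def castEntryImpl (e : EnvExtensionEntry) : String := unsafeCast e
/-- Entries of `statusRootExt` are `String`s stored verbatim in the `.olean` (see `Classify.lean`). -/
@[implemented_by castEntryImpl] opaque castEntry : EnvExtensionEntry → String

/-- `--direct`: read ONE `.olean` (no imports) and decode the reports `#status_root` stored in it. -/
def readStoredDirect (root : Name) : IO (Array String) := do
  let path ← findOLean root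
  let (md, _region) ← readModuleData path      -- region intentionally never freed (process exits)
  let mut out := #[]
  for (ext, entries) in md.entries do
    if ext == `HarnessLib.Status.statusRootExt then
      for e in entries do out := out.push (castEntry e)
  return out

/-- Decode stored reports; a report of another `status_version` (e.g. 2, before fact classes) fails to decode and is
skipped with a rebuild hint — `lake build <root>` re-elaborates only the root module (its cone is unchanged). -/
def parseStored (origin : String) (ss : Array String) : IO (Array Report) := do
  let mut out := #[]
  for s in ss do
    match Json.parse s with
    | .error e => IO.eprintln s!"[status] {origin}: skipping a malformed stored report: {e}"
    | .ok j =>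
      match (fromJson? j : Except String Report) with
      | .ok r =>
        if r.status_version == statusVersion then out := out.push r
        else IO.eprintln s!"[status] {origin}: stored report has status_version {r.status_version}, this reader is {statusVersion} — rebuild the root (`lake build <Summits.S.Status.Root>`) or pass --live; skipped"
      | .error e =>
        let v := match j.getObjValAs? Nat "status_version" with | .ok v => toString v | .error _ => "?"
        IO.eprintln s!"[status] {origin}: stored report has status_version {v}, this reader is {statusVersion} ({e}) — rebuild the root (`lake build <Summits.S.Status.Root>`) or pass --live; skipped"
  return out

def run (cli : Cli) : IO UInt32 := do
  let t0 ← IO.monoMsNow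
  initSearchPath (← findSysroot)          -- + LEAN_PATH (set by `lake env` / `lake exe`)
  let roots ← if cli.roots.isEmpty then discoverRoots cli.leanDir else pure cli.roots
  if roots.isEmpty then
    IO.eprintln s!"[status] no roots: pass --root Summits.<S>.Status.Root or run from lean/ (no Summits/*/Status/Root.lean under '{cli.leanDir}')"
    return 2
  -- keep only roots whose .olean exists (unbuilt roots are reported, not fatal)
  let mut built : Array Name := #[]
  for m in roots do
    match ← (findOLean m).toBaseIO with
    | .ok p => if ← p.pathExists then built := built.push m else IO.eprintln s!"[status] root {m}: no .olean at {p} (not built) — skipped"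
    | .error _ => IO.eprintln s!"[status] root {m}: not found in the search path (not built?) — skipped"
  if built.isEmpty then IO.eprintln "[status] none of the roots is built"; return 2
  let mut reports : Array Report := #[]
  let mut mode := ""
  if cli.direct && !cli.live then
    mode := "direct"
    for m in built do
      let rs ← parseStored (toString m) (← readStoredDirect m)
      if rs.isEmpty then IO.eprintln s!"[status] root {m}: no stored report in its .olean (body lacks `#status_root`?) — skipped in --direct mode"
      reports := reports ++ rs
    if reports.isEmpty then IO.eprintln "[status] --direct found no stored reports; rerun without --direct (env load, live classify)"; return 2
  else
    enableInits
    let env ← importModules (built.map ({ module := · })) {} (trustLevel := 1024) (leakEnv := true) (loadExts := true)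
    let env := env.setMainModule `_status
    let t1 ← IO.monoMsNow
    unless cli.quiet do
      IO.eprintln s!"[status] imported {built.size} root(s): {t1 - t0} ms, {env.header.modules.size} modules, {env.constants.map₁.size} constants"
    let stored ← if cli.live then pure #[] else parseStored "imported roots" (statusRootExt.getState env)
    if !cli.live && !stored.isEmpty then
      mode := "stored"
      reports := stored
    else
      mode := "live"
      unless cli.live do IO.eprintln "[status] no stored reports in these roots (no `#status_root`?) — classifying live"
      let cfg : Config := { includeHere := false, legacyCruxTags := cli.legacy, creditParametrised := cli.creditParam }
      let ctx : Core.Context := { fileName := "<status>", fileMap := FileMap.ofString "", maxHeartbeats := 0 }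
      let (rep, _, _) ← (classify cfg).toIO ctx { env }
      reports := #[rep]
  let rep := cli.filter.apply (Report.merge reports)
  if cli.json then IO.println (rep.toJsonDoc (notes := cli.notes)).compress
  else IO.print (rep.render (notes := cli.notes))
  unless cli.quiet do
    IO.eprintln s!"[status] mode={mode} roots={built.size} total {(← IO.monoMsNow) - t0} ms"
  return 0

end HarnessLib.Status.Main

/-- Entry point for both `lean --run` and `lake exe status`. -/
def main (args : List String) : IO UInt32 := do
  match HarnessLib.Status.Main.parseArgs args {} with
  | .error e => IO.eprintln e; return 2
  | .ok cli =>
    try HarnessLib.Status.Main.run cli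
    catch e => IO.eprintln s!"[status] error: {e}"; return 1
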